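import Literature.Geometry.Kaehler.HodgeStarBasisProofs

/-!
# The pointwise Hodge star in an arbitrary orthonormal frame, and its naturality

Trunk: Kähler / Hodge (notion `riemannian_metric`). Purpose: the algebraic layer underneath the
chart computation of the Hodge star of a Riemannian manifold — the formula
`(⋆β)(w) = ∑ₛ β(b_s) · vol(b_s, w)` as an honest function of a *frame* `b` and a *top form* `vol`,
plus its naturality under pull-back. It was written for the corrected form of the (mis-stated)
named fact `Literature.Geometry.Kaehler.mcoderiv_mcoderiv` (`RiemannianHodge.lean`), whose proof
needs smoothness of `⋆α`; that smoothness has meanwhile been proved in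
`Literature/Geometry/Kaehler/RiemannianHodgeSmoothProofs.lean` (`IsSmoothForm.hodgeStar`), whose
chart lemma `MForm.inChart_hodgeStar_eq` *inlines* exactly the sum that `hodgeStarFrame` packages
(its right-hand side is `hodgeStarFrame k (onFrameModel …) (vol.inChart x₀ y) h (α.inChart x₀ y)`
up to `hodgeStarFrame_eq_sum`); a later librarian pass can restate that lemma through
`hodgeStarFrame` and `hodgeStarFrame_compContinuousLinearMap`. Nothing here is needed to close a
gap in that file.

`Literature.Geometry.Kaehler.hodgeStar o h` (`HodgeStar.lean`) is *defined* by the sum over the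
fixed orthonormal basis `b = stdOrthonormalBasisFin V n` (a choice), and the named fact
`hodgeStar_apply_eq_sum` (discharged in `HodgeStarBasisProofs.lean`) says that *any* orthonormal
basis computes the same value (Warner, GTM 94, Ch. 2, Exercise 13 (2)–(3), p. 80: `*` "is
well-defined by the requirement that for *any* orthonormal basis …"). Contents:

* `Literature.Geometry.Kaehler.frameMultiIndex c s`: the `k`-tuple `(c s₀, …, c s_{k-1})` of a
  frame `c : Fin n → V` attached to an increasing multi-index `s` (so that
  `b.multiIndex s = frameMultiIndex ⇑b s` for an orthonormal basis `b`);
* `Literature.Geometry.Kaehler.hodgeStarFrame c Ω h`: the linear map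
  `β ↦ (w ↦ ∑ₛ β(c_s) · Ω(c_s, w))` attached to a frame `c` and a top form `Ω` — the right-hand
  side of Warner's formula, with no inner product in sight;
* `hodgeStar_eq_hodgeStarFrame`: `⋆_o = hodgeStarFrame ⇑b o.volumeFormL` for every orthonormal
  basis `b` (the fact `hodgeStar_apply_eq_sum`);
* `hodgeStarFrame_compContinuousLinearMap` (naturality): pulling back along a continuous linear
  map `T : W →L[ℝ] V` turns the frame sum for the frame `T ∘ ĉ` into the frame sum for `ĉ` with
  `Ω` and `β` pulled back — the algebraic identity behind "compute `⋆` in a chart using the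
  Gram–Schmidt frame of the coordinate vector fields" (Warner, GTM 94, 4.10, pp. 149–150).

## References

* F. W. Warner, *Foundations of Differentiable Manifolds and Lie Groups*, GTM 94, Springer (1983),
  Ch. 2, Exercise 13, pp. 79–80; 4.10 (6), p. 150.
-/

noncomputable section

open Module ContinuousAlternatingMap Function Set.powersetCard

namespace Literature.Geometry.Kaehler

/-! ### Frame sums -/

section MultiIndex

variable {V : Type*} {n k : ℕ}

/-- The `k`-tuple `(c s₀, …, c s_{k-1})` of vectors of a frame `c : Fin n → V` attached to an
increasing multi-index `s = {s₀ < ⋯ < s_{k-1}} ⊆ Fin n` (via `Set.powersetCard.ofFinEmbEquiv`);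
for an orthonormal basis `b`, `b.multiIndex s = frameMultiIndex ⇑b s`
(Warner, GTM 94, 2.6 and Ex. 2.13). [folklore] -/
def frameMultiIndex (c : Fin n → V) (s : Set.powersetCard (Fin n) k) : Fin k → V :=
  fun i ↦ c (ofFinEmbEquiv.symm s i)

/-- Unfolding of `frameMultiIndex`. [folklore] -/
@[simp]
theorem frameMultiIndex_apply (c : Fin n → V) (s : Set.powersetCard (Fin n) k) (i : Fin k) :
    frameMultiIndex c s i = c (ofFinEmbEquiv.symm s i) :=
  rfl

/-- `frameMultiIndex` commutes with post-composition by any map of frames. [folklore] -/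
theorem frameMultiIndex_comp {W : Type*} (T : W → V) (c : Fin n → W)
    (s : Set.powersetCard (Fin n) k) : frameMultiIndex (T ∘ c) s = T ∘ frameMultiIndex c s :=
  rfl

/-- For an orthonormal basis `b` of an inner product space, `b.multiIndex s` is the frame
multi-index of the frame `⇑b` (definitional). [folklore] -/
theorem multiIndex_eq_frameMultiIndex {V : Type*} [NormedAddCommGroup V] [InnerProductSpace ℝ V]
    (b : OrthonormalBasis (Fin n) ℝ V) (s : Set.powersetCard (Fin n) k) :
    b.multiIndex s = frameMultiIndex (⇑b) s :=
  rfl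

end MultiIndex

section Frame

variable {V : Type*} [NormedAddCommGroup V] [NormedSpace ℝ V] {n k m : ℕ}

variable (k) in
/-- The **frame form of the Hodge star**: for a frame `c : Fin n → V`, a top-degree form `Ω` and
`h : k + m = n`, the linear map `β ↦ (w ↦ ∑ₛ β(c_s) · Ω(c_s, w))`, the sum over increasing
multi-indices `s` of length `k`. For an orthonormal basis `c = ⇑b` of an oriented inner product
space and `Ω = o.volumeFormL` this *is* the Hodge star (`hodgeStar_eq_hodgeStarFrame`; Warner,
GTM 94, Ch. 2, Ex. 13 (2)–(3), p. 80), but the expression makes sense — and is polynomial — in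
`(c, Ω, β)` without any inner product. [cite: WarnerGTM94, Ch. 2 Ex. 13 (2)-(3), p. 80] -/
def hodgeStarFrame (c : Fin n → V) (Ω : V [⋀^Fin n]→L[ℝ] ℝ) (h : k + m = n) :
    (V [⋀^Fin k]→L[ℝ] ℝ) →ₗ[ℝ] (V [⋀^Fin m]→L[ℝ] ℝ) :=
  ∑ s : Set.powersetCard (Fin n) k,
    (ContinuousAlternatingMap.apply ℝ V ℝ (frameMultiIndex c s)).toLinearMap.smulRight
      ((Ω.domDomCongr (finCongr (show n = m + k by omega))).interiorProductMulti k
        (frameMultiIndex c s))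

/-- Unfolding of `hodgeStarFrame`: `(hodgeStarFrame c Ω h β) w = ∑ₛ β(c_s) · Ω(c_s, w)`. [folklore] -/
@[simp]
theorem hodgeStarFrame_apply (c : Fin n → V) (Ω : V [⋀^Fin n]→L[ℝ] ℝ) (h : k + m = n)
    (β : V [⋀^Fin k]→L[ℝ] ℝ) (w : Fin m → V) :
    hodgeStarFrame k c Ω h β w = ∑ s : Set.powersetCard (Fin n) k,
      β (frameMultiIndex c s) *
        (Ω.domDomCongr (finCongr (show n = m + k by omega))).interiorProductMulti k
          (frameMultiIndex c s) w := by
  simp [hodgeStarFrame, LinearMap.sum_apply]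

/-- `hodgeStarFrame` as a sum of forms: `hodgeStarFrame c Ω h β = ∑ₛ β(c_s) • Ω(c_s, ·)`. [folklore] -/
theorem hodgeStarFrame_eq_sum (c : Fin n → V) (Ω : V [⋀^Fin n]→L[ℝ] ℝ) (h : k + m = n)
    (β : V [⋀^Fin k]→L[ℝ] ℝ) :
    hodgeStarFrame k c Ω h β = ∑ s : Set.powersetCard (Fin n) k,
      β (frameMultiIndex c s) •
        (Ω.domDomCongr (finCongr (show n = m + k by omega))).interiorProductMulti k
          (frameMultiIndex c s) := by
  simp [hodgeStarFrame, LinearMap.sum_apply]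

end Frame

/-! ### The Hodge star is the frame sum of any orthonormal basis -/

section Orthonormal

variable {V : Type*} [NormedAddCommGroup V] [InnerProductSpace ℝ V] [FiniteDimensional ℝ V]
  {n : ℕ} [Fact (finrank ℝ V = n)] (o : Orientation ℝ V (Fin n)) {k m : ℕ}

/-- **The Hodge star in an arbitrary orthonormal frame**: for every orthonormal basis `b` of the
oriented inner product space `V`, `⋆_o β = hodgeStarFrame ⇑b o.volumeFormL h β`, i.e.
`(⋆β)(w) = ∑ₛ β(b_s) vol(b_s, w)`. This is the named fact `hodgeStar_apply_eq_sum`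
(`hodgeStar_apply_eq_sum_holds`), Warner, GTM 94, Ch. 2, Exercise 13 (2)–(3), p. 80 ("for *any*
orthonormal basis"). [cite: WarnerGTM94, Ch. 2 Ex. 13 (2)-(3), p. 80] -/
theorem hodgeStar_eq_hodgeStarFrame (b : OrthonormalBasis (Fin n) ℝ V) (h : k + m = n)
    (β : V [⋀^Fin k]→L[ℝ] ℝ) : hodgeStar o h β = hodgeStarFrame k (⇑b) o.volumeFormL h β := by
  ext w
  rw [hodgeStarFrame_apply]
  exact hodgeStar_apply_eq_sum_holds o b h β w

end Orthonormal

/-! ### Naturality of the frame sum under pull-back -/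

section Naturality

variable {V W : Type*} [NormedAddCommGroup V] [NormedSpace ℝ V] [NormedAddCommGroup W]
  [NormedSpace ℝ W] {n k m : ℕ}

/-- `Fin.append` commutes with post-composition (= `HodgeStarWedge.append_comp_eq.symm`, i.e.
`Literature.Geometry.Kaehler.append_comp_eq` of `HodgeStarWedge.lean` read backwards; kept here to
avoid importing the wedge layer — candidate for merging downwards). [folklore] -/
theorem comp_fin_append {α β : Type*} (f : α → β) {a b : ℕ} (u : Fin a → α) (v : Fin b → α) :
    f ∘ Fin.append u v = Fin.append (f ∘ u) (f ∘ v) := by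
  funext i
  refine Fin.addCases (fun j ↦ ?_) (fun j ↦ ?_) i <;> simp

/-- Reindexing commutes with pull-back along a continuous linear map. [folklore] -/
theorem domDomCongr_compContinuousLinearMap {ι ι' : Type*} (σ : ι ≃ ι')
    (Ω : V [⋀^ι]→L[ℝ] ℝ) (T : W →L[ℝ] V) :
    (Ω.compContinuousLinearMap T).domDomCongr σ = (Ω.domDomCongr σ).compContinuousLinearMap T :=
  rfl

/-- The iterated interior product of a pulled-back form: contracting `T^*Ω` with `v` and evaluating
at `w` is contracting `Ω` with `T ∘ v` and evaluating at `T ∘ w`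
(= `RiemannianHodgeSmoothProofs.interiorProductMulti_domDomCongr_compContinuousLinearMap` with
`σ = Equiv.refl`; candidate for moving that lemma here, below the manifold layer). [folklore] -/
theorem interiorProductMulti_compContinuousLinearMap_apply (Ω : V [⋀^Fin (m + k)]→L[ℝ] ℝ)
    (T : W →L[ℝ] V) (v : Fin k → W) (w : Fin m → W) :
    (Ω.compContinuousLinearMap T).interiorProductMulti k v w =
      Ω.interiorProductMulti k (T ∘ v) (T ∘ w) := by
  rw [interiorProductMulti_apply, interiorProductMulti_apply, compContinuousLinearMap_apply,
    ← Function.comp_assoc, comp_fin_append]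

/-- Pull-back form of the previous lemma: `ι_v (T^*Ω) = T^* (ι_{T∘v} Ω)` (again the `σ = Equiv.refl`
case of `RiemannianHodgeSmoothProofs.interiorProductMulti_domDomCongr_compContinuousLinearMap`,
stated as an identity of forms). [folklore] -/
theorem interiorProductMulti_compContinuousLinearMap (Ω : V [⋀^Fin (m + k)]→L[ℝ] ℝ)
    (T : W →L[ℝ] V) (v : Fin k → W) :
    (Ω.compContinuousLinearMap T).interiorProductMulti k v =
      (Ω.interiorProductMulti k (T ∘ v)).compContinuousLinearMap T := by
  ext w
  rw [interiorProductMulti_compContinuousLinearMap_apply, compContinuousLinearMap_apply]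

/-- **Naturality of the frame sum.** For a continuous linear map `T : W →L[ℝ] V`, a frame `ĉ` of
`W`, a top form `Ω` and a `k`-form `β` on `V`: pulling back `hodgeStarFrame (T ∘ ĉ) Ω h β` along `T`
gives the frame sum of `ĉ` for the pulled-back forms `T^*Ω`, `T^*β`. With `T` the tangent
coordinate change of a chart and `ĉ` the Gram–Schmidt frame read in the chart, this is the chart
formula for `⋆` (Warner, GTM 94, 4.10 (6), p. 150). [folklore] -/
theorem hodgeStarFrame_compContinuousLinearMap (T : W →L[ℝ] V) (ĉ : Fin n → W)
    (Ω : V [⋀^Fin n]→L[ℝ] ℝ) (h : k + m = n) (β : V [⋀^Fin k]→L[ℝ] ℝ) :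
    (hodgeStarFrame k (T ∘ ĉ) Ω h β).compContinuousLinearMap T =
      hodgeStarFrame k ĉ (Ω.compContinuousLinearMap T) h (β.compContinuousLinearMap T) := by
  ext w
  rw [compContinuousLinearMap_apply, hodgeStarFrame_apply, hodgeStarFrame_apply]
  refine Finset.sum_congr rfl fun s _ ↦ ?_
  rw [domDomCongr_compContinuousLinearMap, interiorProductMulti_compContinuousLinearMap_apply,
    compContinuousLinearMap_apply, frameMultiIndex_comp]

/-- The frame sum is additive in the form `β` (it is a linear map). [folklore] -/
theorem hodgeStarFrame_map_add (c : Fin n → V) (Ω : V [⋀^Fin n]→L[ℝ] ℝ) (h : k + m = n)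
    (β γ : V [⋀^Fin k]→L[ℝ] ℝ) :
    hodgeStarFrame k c Ω h (β + γ) = hodgeStarFrame k c Ω h β + hodgeStarFrame k c Ω h γ :=
  map_add _ β γ

end Naturality

end Literature.Geometry.Kaehler
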